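import Mathlib
import Summits.QuantumFields.YangMills.Theorems.CoincidenceRotationBootstrapHypercubicLimitOneFieldWeak
import Summits.QuantumFields.YangMills.Theorems.ScalingWindowSplitEuclideanUpgrade
import Summits.QuantumFields.YangMills.Theorems.MirrorModularBoostsHypercubicLimitCouplingResponseDefs
import HarnessLib

/-!
# `ContinuumFromLatticeGap` (stmt-QuantumFields-15915), line `registered`, reshape 3: per-`G` packaging glue

Support file for the crux item stmt-QuantumFields-15915
(`Summit.QuantumFields.YangMills.Theses.GronwallGap.ContinuumFromLatticeGap`), line `registered`, RESHAPE 3 (dock on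
the filed lattice split of route `ScalingWindowSplit`).  The registered anchor `stub_unitToZero` (the pinned unit tends to zero) and two pieces of pure bookkeeping, stated AT ONE GAUGE GROUP `G`
(the landed originals are global statements over all `G` and cannot be instantiated at one group):

* `hypercubicAt_of_oneField` — ONE FIELD SUFFICES at `G`: from `r`, a weak-coupling scheme `sch` and one Schwinger
  family `S₁` with the one-field clauses `OneFieldClauses r sch S₁`, the body of
  `CoincidenceRotationBootstrap.HypercubicLimit` at `G` (silence every other species — `β` untouched —, extend the
  one-field family by zero); the `←` half of the landed `hypercubicLimit_iff_oneFieldWeak`, per `G`.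
* `concl_of_hypercubicAt` — THE CLAY `G`-CLAUSE FROM A `HypercubicLimit` WITNESS AT `G`: given orientation amnesia
  `CoincidenceRotationBootstrap.CurvatureAmnesia` (stmt-QuantumFields-16192, a HYPOTHESIS by name) and the density
  upgrade (PROVED, `ScalingWindowSplit.euclideanUpgrade_proof`), the species bookkeeping of the deciding theorem
  `CoincidenceRotationBootstrap.closes`, per `G`: non-curvature species renormalised to `0`, `S' := S` on all-curvature
  strings and `0` elsewhere, E0–E4 of `S'`, E1 rotations by the upgrade fed proper-hypercubic invariance and the Σ5
  invariance of curvature strings, `IsYangMillsFor`, non-triviality, non-Gaussianity, the two gaps.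

No definitions, no new notation, no named facts; Mathlib + landed tree lemmas only.
References: Osterwalder–Schrader, CMP 31 (1973) §3 (the axioms E0–E4); Jaffe–Witten (2000) §4 fn. 1 (species
renormalised to zero).
-/

noncomputable section

namespace Summit.QuantumFields.YangMills.Theorems.ContinuumFromLatticeGap

open scoped SchwartzMap
open Filter Topology MeasureTheory
open Literature.MathematicalPhysics.QuantumFieldTheory Literature.MathematicalPhysics.QuantumLattice
  Literature.MathematicalPhysics.AQFT
open Summit.QuantumFields.YangMills.Theses
open Summit.QuantumFields.YangMills.Theorems.HypercubicLimit.Negative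
open Summit.QuantumFields.YangMills.Theorems.HypercubicLimit.OneFieldWeak
open Summit.QuantumFields.YangMills.Cruxes.HypercubicLimit.CouplingResponse (OneFieldClauses)

/-- **`stub_unitToZero`** (registered anchor of line `registered`, reshape 3; a step of its composition): spacings
pinned to critical locked rates along a subsequence — `0 < a_k`, `Δ₀ a_k ≤ m̂(φ k)`, `φ` strictly increasing, `m̂ → 0` —
tend to `0` (squeeze between `0` and `m̂(φ k)/Δ₀`). [folklore] -/
theorem stub_unitToZero : ∀ (a mh : ℕ → ℝ) (φ : ℕ → ℕ) (Δ₀ : ℝ), (∀ k, 0 < a k) → StrictMono φ → 0 < Δ₀ →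
    (∀ k, Δ₀ * a k ≤ mh (φ k)) → Tendsto mh atTop (𝓝 0) → Tendsto a atTop (𝓝 0) := by
  intro a mh φ Δ₀ ha hφ hΔ₀ hpin hmh
  have hmφ : Tendsto (fun k => mh (φ k) / Δ₀) atTop (𝓝 0) := by
    simpa using (hmh.comp hφ.tendsto_atTop).div_const Δ₀
  refine squeeze_zero (fun k => (ha k).le) (fun k => ?_) hmφ
  rw [le_div_iff₀ hΔ₀]
  linarith [hpin k]

variable {G : Type} [Group G] [TopologicalSpace G] [IsTopologicalGroup G] [CompactSpace G]

/-- **One field suffices, at one group** (the `←` half of the landed `hypercubicLimit_iff_oneFieldWeak`, per `G`):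
from `r`, a weak-coupling scheme and ONE Schwinger family with the one-field clauses, the body of
`CoincidenceRotationBootstrap.HypercubicLimit` at `G` — silence every other species (`β` untouched) and extend the
one-field family by zero. [cite: OsterwalderSchrader1973, §3] -/
theorem hypercubicAt_of_oneField (r : letI : MeasurableSpace G := borel G; LatticeRep G)
    (sch : SpeciesScheme (letI : MeasurableSpace G := borel G; YMSpecies G))
    (S₁ : SchwingerFamily (EuclideanSpace ℝ (Fin 4)))
    (hw : sch.HasWeakCouplingLimit)
    (h : letI : MeasurableSpace G := borel G; haveI : BorelSpace G := ⟨rfl⟩; OneFieldClauses r sch S₁) :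
    letI : MeasurableSpace G := borel G
    haveI : BorelSpace G := ⟨rfl⟩
    ∃ (r : LatticeRep G) (sch : SpeciesScheme (YMSpecies G))
      (S : LabelledSchwingerFamily (YMSpecies G) (EuclideanSpace ℝ (Fin 4))),
      sch.HasWeakCouplingLimit ∧
      (S.IsNormalized ∧ S.IsHermitian ∧ S.HasLinearGrowth ∧ S.IsReflectionPositive ∧ S.IsSymmetric ∧
        S.HasClusterProperty ∧
        (∀ (n : ℕ) (k : Fin n → YMSpecies G) (a : EuclideanSpace ℝ (Fin 4))
          (F : 𝓢((Fin n → EuclideanSpace ℝ (Fin 4)), ℂ)), IsOffDiagonal F → S n k (translateMulti a F) = S n k F) ∧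
        (∀ (n : ℕ) (k : Fin n → YMSpecies G) (R : EuclideanSpace ℝ (Fin 4) ≃ₗᵢ[ℝ] EuclideanSpace ℝ (Fin 4)),
          LinearMap.det (R.toLinearEquiv : EuclideanSpace ℝ (Fin 4) →ₗ[ℝ] EuclideanSpace ℝ (Fin 4)) = 1 →
          (∀ i : Fin 4, ∃ j : Fin 4, R (EuclideanSpace.single i 1) = EuclideanSpace.single j 1 ∨
            R (EuclideanSpace.single i 1) = -EuclideanSpace.single j 1) →
          ∀ F : 𝓢((Fin n → EuclideanSpace ℝ (Fin 4)), ℂ), IsOffDiagonal F → S n k (linActMulti R F) = S n k F)) ∧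
      (∀ (n : ℕ), n ≠ 0 → ∀ (σ : Fin n → YMSpecies G) (f : Fin n → 𝓢(EuclideanSpace ℝ (Fin 4), ℝ))
          (F : 𝓢((Fin n → EuclideanSpace ℝ (Fin 4)), ℂ)), IsTensorOf F (fun i => ofRealTest (f i)) →
          IsOffDiagonal F →
          Tendsto (fun k : ℕ => ((latticeSchwinger r.ρ sch (fun s => s.F) k n σ f : ℝ) : ℂ)) atTop (𝓝 (S n σ F))) ∧
      (∃ (F₁ G₁ : 𝓢((Fin 1 → EuclideanSpace ℝ (Fin 4)), ℂ)) (H₁ : 𝓢((Fin (1 + 1) → EuclideanSpace ℝ (Fin 4)), ℂ)),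
        IsTimeOrdered F₁ ∧ IsTimeOrdered G₁ ∧ IsAppendTensorOf H₁ (osAdjoint F₁) G₁ ∧
          S (1 + 1) (fun _ => r.curvature) H₁ ≠
            S 1 (fun _ => r.curvature) (osAdjoint F₁) * S 1 (fun _ => r.curvature) G₁) ∧
      (∃ (f g h : 𝓢(EuclideanSpace ℝ (Fin 4), ℂ)) (Ffgh : 𝓢((Fin 3 → EuclideanSpace ℝ (Fin 4)), ℂ))
          (Fgh Ffh Ffg : 𝓢((Fin 2 → EuclideanSpace ℝ (Fin 4)), ℂ)) (Ff Fg Fh : 𝓢((Fin 1 → EuclideanSpace ℝ (Fin 4)), ℂ)),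
        IsTensorOf Ffgh ![f, g, h] ∧ IsOffDiagonal Ffgh ∧ IsTensorOf Fgh ![g, h] ∧ IsTensorOf Ffh ![f, h] ∧
        IsTensorOf Ffg ![f, g] ∧ IsTensorOf Ff ![f] ∧ IsTensorOf Fg ![g] ∧ IsTensorOf Fh ![h] ∧
          S 3 (fun _ => r.curvature) Ffgh - S 1 (fun _ => r.curvature) Ff * S 2 (fun _ => r.curvature) Fgh -
            S 1 (fun _ => r.curvature) Fg * S 2 (fun _ => r.curvature) Ffh -
            S 1 (fun _ => r.curvature) Fh * S 2 (fun _ => r.curvature) Ffg +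
            2 * (S 1 (fun _ => r.curvature) Ff * S 1 (fun _ => r.curvature) Fg * S 1 (fun _ => r.curvature) Fh) ≠ 0) ∧
      (∃ Δ : ℝ, 0 < Δ ∧ S.HasMassGap Δ ∧ HasLatticeMassGap r sch Δ) := by
  letI : MeasurableSpace G := borel G
  haveI : BorelSpace G := ⟨rfl⟩
  obtain ⟨hos, hconv, hnt, hng, Δ, hΔ, hgap, hlat⟩ := h
  refine ⟨r, { sch with c := fun s k => by classical exact if s = r.curvature then sch.c s k else 0 },
    extendByZero r.curvature S₁, hw, osClauses_extendByZero hos, ?_, ?_, ?_, Δ, hΔ, hasMassGap_extendByZero hgap, hlat⟩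
  · intro n hn σ f F hF hod
    by_cases hσ : ∀ i, σ i = r.curvature
    · obtain rfl : σ = fun _ => r.curvature := funext hσ
      rw [extendByZero_const]
      simp_rw [latticeSchwinger_silence_self]
      exact hconv n hn f F hF hod
    · push Not at hσ
      obtain ⟨i₀, hi₀⟩ := hσ
      rw [extendByZero_of_not_all _ _ (fun hall => hi₀ (hall i₀))]
      simp_rw [latticeSchwinger_silence_of_ne r sch r.curvature _ n σ f hi₀]
      simp
  · simpa using hnt
  · simpa using hng

/-- **The Clay `G`-clause from a `HypercubicLimit` witness at one group** (the body of the deciding theorem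
`CoincidenceRotationBootstrap.closes`, per `G`): given orientation amnesia (`CurvatureAmnesia`, stmt-16192, by NAME)
and the density upgrade (`EuclideanUpgrade`, PROVED: `euclideanUpgrade_proof`), a weak-coupling labelled witness with
E0, E0′, E2–E4, translations, proper-hypercubic invariance, convergence, non-triviality, non-Gaussianity and the two
gaps is repackaged — non-curvature species renormalised to `0`, `S' := S` on all-curvature strings and `0` elsewhere —
into OS data `T` with `IsYangMillsFor`, `IsNontrivial`, `IsNonGaussian`, `HasMassGap Δ ∧ HasLatticeMassGap Δ`.
-- adapted from Theses/CoincidenceRotationBootstrap.lean (`closes`) [cite: OsterwalderSchrader1973, §3] [cite: JaffeWitten2000, §4 fn. 1] -/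
theorem concl_of_hypercubicAt (h₁ : CoincidenceRotationBootstrap.CurvatureAmnesia)
    (hG : IsCompactSimpleLieGroup G)
    (h₂ : letI : MeasurableSpace G := borel G; haveI : BorelSpace G := ⟨rfl⟩;
      ∃ (r : LatticeRep G) (sch : SpeciesScheme (YMSpecies G))
        (S : LabelledSchwingerFamily (YMSpecies G) (EuclideanSpace ℝ (Fin 4))),
        sch.HasWeakCouplingLimit ∧
        (S.IsNormalized ∧ S.IsHermitian ∧ S.HasLinearGrowth ∧ S.IsReflectionPositive ∧ S.IsSymmetric ∧
          S.HasClusterProperty ∧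
          (∀ (n : ℕ) (k : Fin n → YMSpecies G) (a : EuclideanSpace ℝ (Fin 4))
            (F : 𝓢((Fin n → EuclideanSpace ℝ (Fin 4)), ℂ)), IsOffDiagonal F → S n k (translateMulti a F) = S n k F) ∧
          (∀ (n : ℕ) (k : Fin n → YMSpecies G) (R : EuclideanSpace ℝ (Fin 4) ≃ₗᵢ[ℝ] EuclideanSpace ℝ (Fin 4)),
            LinearMap.det (R.toLinearEquiv : EuclideanSpace ℝ (Fin 4) →ₗ[ℝ] EuclideanSpace ℝ (Fin 4)) = 1 →
            (∀ i : Fin 4, ∃ j : Fin 4, R (EuclideanSpace.single i 1) = EuclideanSpace.single j 1 ∨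
              R (EuclideanSpace.single i 1) = -EuclideanSpace.single j 1) →
            ∀ F : 𝓢((Fin n → EuclideanSpace ℝ (Fin 4)), ℂ), IsOffDiagonal F → S n k (linActMulti R F) = S n k F)) ∧
        (∀ (n : ℕ), n ≠ 0 → ∀ (σ : Fin n → YMSpecies G) (f : Fin n → 𝓢(EuclideanSpace ℝ (Fin 4), ℝ))
            (F : 𝓢((Fin n → EuclideanSpace ℝ (Fin 4)), ℂ)), IsTensorOf F (fun i => ofRealTest (f i)) →
            IsOffDiagonal F →
            Tendsto (fun k : ℕ => ((latticeSchwinger r.ρ sch (fun s => s.F) k n σ f : ℝ) : ℂ)) atTop (𝓝 (S n σ F))) ∧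
        (∃ (F₁ G₁ : 𝓢((Fin 1 → EuclideanSpace ℝ (Fin 4)), ℂ)) (H₁ : 𝓢((Fin (1 + 1) → EuclideanSpace ℝ (Fin 4)), ℂ)),
          IsTimeOrdered F₁ ∧ IsTimeOrdered G₁ ∧ IsAppendTensorOf H₁ (osAdjoint F₁) G₁ ∧
            S (1 + 1) (fun _ => r.curvature) H₁ ≠
              S 1 (fun _ => r.curvature) (osAdjoint F₁) * S 1 (fun _ => r.curvature) G₁) ∧
        (∃ (f g h : 𝓢(EuclideanSpace ℝ (Fin 4), ℂ)) (Ffgh : 𝓢((Fin 3 → EuclideanSpace ℝ (Fin 4)), ℂ))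
            (Fgh Ffh Ffg : 𝓢((Fin 2 → EuclideanSpace ℝ (Fin 4)), ℂ)) (Ff Fg Fh : 𝓢((Fin 1 → EuclideanSpace ℝ (Fin 4)), ℂ)),
          IsTensorOf Ffgh ![f, g, h] ∧ IsOffDiagonal Ffgh ∧ IsTensorOf Fgh ![g, h] ∧ IsTensorOf Ffh ![f, h] ∧
          IsTensorOf Ffg ![f, g] ∧ IsTensorOf Ff ![f] ∧ IsTensorOf Fg ![g] ∧ IsTensorOf Fh ![h] ∧
            S 3 (fun _ => r.curvature) Ffgh - S 1 (fun _ => r.curvature) Ff * S 2 (fun _ => r.curvature) Fgh -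
              S 1 (fun _ => r.curvature) Fg * S 2 (fun _ => r.curvature) Ffh -
              S 1 (fun _ => r.curvature) Fh * S 2 (fun _ => r.curvature) Ffg +
              2 * (S 1 (fun _ => r.curvature) Ff * S 1 (fun _ => r.curvature) Fg * S 1 (fun _ => r.curvature) Fh) ≠ 0) ∧
        (∃ Δ : ℝ, 0 < Δ ∧ S.HasMassGap Δ ∧ HasLatticeMassGap r sch Δ)) :
    letI : MeasurableSpace G := borel G
    haveI : BorelSpace G := ⟨rfl⟩
    ∃ (r : LatticeRep G) (sch : SpeciesScheme (YMSpecies G)) (T : OSData (YMSpecies G) 4),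
      sch.HasWeakCouplingLimit ∧ IsYangMillsFor r sch T ∧ T.IsNontrivial r.curvature ∧
        T.IsNonGaussian r.curvature ∧ ∃ Δ > 0, T.HasMassGap Δ ∧ HasLatticeMassGap r sch Δ := by
  classical
  have h₃ : ScalingWindowSplit.EuclideanUpgrade :=
    Summit.QuantumFields.YangMills.Theorems.ScalingWindowSplit.euclideanUpgrade_proof
  letI : MeasurableSpace G := borel G
  haveI : BorelSpace G := ⟨rfl⟩
  obtain ⟨r, sch, S, hW, hax, hYM, hNT, hNG, Δ, hΔ, hg1, hg2⟩ := h₂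
  have hsig := h₁ G hG r sch S hW hax hYM hNT ⟨Δ, hΔ, hg1, hg2⟩
  obtain ⟨h0, hh, hg, hrp, hsy, hcl, htr, hcub⟩ := hax
  -- label-string bookkeeping
  have hrev : ∀ {ι : Type} {n : ℕ} (k : Fin n → ι) (c : ι), (∀ i, (k ∘ Fin.rev) i = c) ↔ ∀ i, k i = c :=
    fun k c => ⟨fun h i => by simpa using h (Fin.rev i), fun h i => h _⟩
  have happ : ∀ {ι : Type} {n m : ℕ} (k : Fin n → ι) (k' : Fin m → ι) (c : ι),
      (∀ i, Fin.append k k' i = c) ↔ (∀ i, k i = c) ∧ ∀ j, k' j = c := by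
    intro ι n m k k' c
    refine ⟨fun h => ⟨fun i => by simpa using h (Fin.castAdd m i), fun j => by simpa using h (Fin.natAdd n j)⟩,
      fun h i => ?_⟩
    induction i using Fin.addCases with
    | left i => simpa using h.1 i
    | right j => simpa using h.2 j
  have hcst : ∀ {ι : Type} {a b : ℕ} (c : ι),
      Fin.append ((fun _ : Fin a => c) ∘ Fin.rev) (fun _ : Fin b => c) = fun _ => c := by
    intro ι a b c
    funext i
    induction i using Fin.addCases with
    | left i => simp
    | right j => simp
  -- the projected scheme and its lattice correlations
  let sch' := { sch with c := fun s j => if s = r.curvature then sch.c s j else 0 }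
  have hself : ∀ (j n : ℕ) (f : Fin n → SchwartzMap (EuclideanSpace ℝ (Fin 4)) ℝ),
      Literature.MathematicalPhysics.QuantumFieldTheory.latticeSchwinger r.ρ sch' (fun s => s.F) j n
        (fun _ => r.curvature) f = Literature.MathematicalPhysics.QuantumFieldTheory.latticeSchwinger
          r.ρ sch (fun s => s.F) j n (fun _ => r.curvature) f := by
    intro j n f
    have hc : sch'.c r.curvature j = sch.c r.curvature j := if_pos rfl
    unfold Literature.MathematicalPhysics.QuantumFieldTheory.latticeSchwinger
    simp_rw [hc]
    rfl
  have hne : ∀ (j n : ℕ) (σ : Fin n → _) (f : Fin n → SchwartzMap (EuclideanSpace ℝ (Fin 4)) ℝ) (i₀ : Fin n),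
      σ i₀ ≠ r.curvature →
        Literature.MathematicalPhysics.QuantumFieldTheory.latticeSchwinger r.ρ sch' (fun s => s.F) j n σ f = 0 := by
    intro j n σ f i₀ hi₀
    have hc : sch'.c (σ i₀) j = 0 := if_neg hi₀
    unfold Literature.MathematicalPhysics.QuantumFieldTheory.latticeSchwinger
    refine integral_eq_zero_of_ae (Filter.Eventually.of_forall fun U => ?_)
    simp only [Pi.zero_apply]
    refine Finset.prod_eq_zero (Finset.mem_univ i₀) ?_
    rw [hc]
    simp [Literature.MathematicalPhysics.QuantumFieldTheory.smearedLatticeField]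
  -- the projected family
  obtain ⟨S', ha, hn⟩ : ∃ S' : Literature.MathematicalPhysics.AQFT.LabelledSchwingerFamily
      (Literature.MathematicalPhysics.QuantumFieldTheory.YMSpecies G) (EuclideanSpace ℝ (Fin 4)),
      (∀ (n : ℕ) (k : Fin n → _), (∀ i, k i = r.curvature) → S' n k = S n (fun _ => r.curvature)) ∧
      (∀ (n : ℕ) (k : Fin n → _), ¬ (∀ i, k i = r.curvature) → S' n k = 0) :=
    ⟨fun n k => if (∀ i, k i = r.curvature) then S n (fun _ => r.curvature) else 0,
      fun n k hk => if_pos hk, fun n k hk => if_neg hk⟩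
  have hac : ∀ n : ℕ, S' n (fun _ => r.curvature) = S n (fun _ => r.curvature) := fun n => ha n _ fun _ => rfl
  refine ⟨r, sch', ⟨S', ?_, ?_, ?_, ⟨?_, ?_⟩, ?_, ?_, ?_⟩, hW, ?_, ?_, ?_, Δ, hΔ, ?_, hg2⟩
  · -- E0 normalisation
    intro k F
    rw [ha 0 k (fun i => i.elim0)]
    exact h0 _ F
  · -- E0 hermiticity
    intro n k F hF
    by_cases hk : ∀ i, k i = r.curvature
    · rw [ha n k hk, ha n _ ((hrev k _).2 hk)]
      exact hh n _ F hF
    · rw [hn n k hk, hn n _ (mt (hrev k _).1 hk)]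
      simp
  · -- E0' linear growth
    intro T
    obtain ⟨s, α, β, hb⟩ := hg {r.curvature}
    refine ⟨s, max α 0, β, fun n k _ F hF => ?_⟩
    have hnn : 0 ≤ (n.factorial : ℝ) ^ β * Literature.MathematicalPhysics.QuantumLattice.schwartzNorm (n * s) F :=
      mul_nonneg (Real.rpow_nonneg (Nat.cast_nonneg _) _)
        (Literature.MathematicalPhysics.QuantumLattice.schwartzNorm_nonneg _ _)
    by_cases hk : ∀ i, k i = r.curvature
    · rw [ha n k hk]
      refine (hb n _ (fun _ => Finset.mem_singleton_self _) F hF).trans ?_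
      rw [mul_assoc, mul_assoc]
      exact mul_le_mul_of_nonneg_right (le_max_left _ _) hnn
    · rw [hn n k hk]
      show ‖(0 : ℂ)‖ ≤ _
      rw [norm_zero, mul_assoc]
      exact mul_nonneg (le_max_right _ _) hnn
  · -- E1 translations
    intro n k a F hF
    by_cases hk : ∀ i, k i = r.curvature
    · rw [ha n k hk]; exact htr n _ a F hF
    · rw [hn n k hk]; rfl
  · -- E1 rotations: the PROVED density upgrade, fed proper-hypercubic invariance and Σ5-invariance
    -- of EVERY species string (curvature strings by CurvatureAmnesia, the others vanish)
    exact h₃ _ S'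
      (fun n k R hR hp F hF => by
        by_cases hk : ∀ i, k i = r.curvature
        · rw [ha n k hk]; exact hcub n _ R hR hp F hF
        · rw [hn n k hk]; rfl)
      (fun R hR n k F hF => by
        by_cases hk : ∀ i, k i = r.curvature
        · rw [ha n k hk]; exact hsig R hR n F hF
        · rw [hn n k hk]; rfl)
  · -- E2 reflection positivity: zero the test functions of label strings that are not all-curvature
    intro N deg lab F hF H hH
    let good : Fin N → Prop := fun j => ∀ i, lab j i = r.curvature
    let F' : (j : Fin N) → SchwartzMap (Fin (deg j) → EuclideanSpace ℝ (Fin 4)) ℂ :=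
      fun j => if good j then F j else 0
    let H' : (i j : Fin N) → SchwartzMap (Fin (deg i + deg j) → EuclideanSpace ℝ (Fin 4)) ℂ :=
      fun i j => if good i ∧ good j then H i j else 0
    have hF' : ∀ j, Literature.MathematicalPhysics.QuantumLattice.IsTimeOrdered (F' j) := fun j => by
      by_cases hj : good j
      · simp only [F', if_pos hj]; exact hF j
      · simp only [F', if_neg hj]
        rw [Literature.MathematicalPhysics.QuantumLattice.IsTimeOrdered,
          show ((0 : SchwartzMap (Fin (deg j) → EuclideanSpace ℝ (Fin 4)) ℂ) :
            (Fin (deg j) → EuclideanSpace ℝ (Fin 4)) → ℂ) = 0 from rfl, tsupport_zero]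
        exact Set.empty_subset _
    have hH' : ∀ i j, Literature.MathematicalPhysics.QuantumLattice.IsAppendTensorOf (H' i j)
        (Literature.MathematicalPhysics.QuantumLattice.osAdjoint (F' i)) (F' j) := fun i j => by
      by_cases hi : good i
      · by_cases hj : good j
        · simp only [H', F', if_pos hi, if_pos hj, if_pos (And.intro hi hj)]; exact hH i j
        · simp only [H', F', if_neg hj, if_neg (fun h : good i ∧ good j => hj h.2)]
          intro x; simp
      · simp only [H', F', if_neg hi, if_neg (fun h : good i ∧ good j => hi h.1)]
        intro x; simp
    have key := hrp N deg (fun j _ => r.curvature) F' hF' H' hH'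
    have hterm : ∀ i j, S' (deg i + deg j) (Fin.append (lab i ∘ Fin.rev) (lab j)) (H i j) =
        S (deg i + deg j) (Fin.append ((fun _ => r.curvature) ∘ Fin.rev) (fun _ => r.curvature)) (H' i j) := by
      intro i j
      by_cases hij : good i ∧ good j
      · rw [ha _ _ ((happ _ _ _).2 ⟨(hrev _ _).2 hij.1, hij.2⟩), hcst]
        simp only [H', if_pos hij]
      · rw [hn _ _ (fun h => hij ⟨(hrev _ _).1 ((happ _ _ _).1 h).1, ((happ _ _ _).1 h).2⟩)]
        simp [H', if_neg hij]
    simp only [hterm]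
    exact key
  · -- E3 symmetry
    intro n k π F hF
    by_cases hk : ∀ i, k i = r.curvature
    · rw [ha n k hk, ha n (k ∘ π) (fun i => hk _)]
      exact hsy n _ π F hF
    · rw [hn n k hk, hn n (k ∘ π) (fun h => hk fun i => by simpa using h (π.symm i))]
      simp
  · -- E4 cluster property
    intro n m k k' F G hF hG a ha0 hane H hH
    by_cases hk : ∀ i, k i = r.curvature
    · by_cases hk' : ∀ j, k' j = r.curvature
      · rw [ha _ _ ((happ _ _ _).2 ⟨(hrev _ _).2 hk, hk'⟩), ha _ _ ((hrev _ _).2 hk), ha _ _ hk']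
        have := hcl n m (fun _ => r.curvature) (fun _ => r.curvature) F G hF hG a ha0 hane H hH
        rw [hcst] at this
        exact this
      · rw [hn _ _ (fun h => hk' ((happ _ _ _).1 h).2), hn _ _ hk']
        simp
    · rw [hn _ _ (fun h => hk ((hrev _ _).1 ((happ _ _ _).1 h).1)), hn _ _ (mt (hrev k _).1 hk)]
      simp
  · -- IsYangMillsFor along the projected scheme
    intro n hn0 σ f F hF hod
    dsimp only
    by_cases hσ : ∀ i, σ i = r.curvature
    · obtain rfl : σ = fun _ => r.curvature := funext hσ
      rw [hac n]
      simp only [hself]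
      exact hYM n hn0 _ f F hF hod
    · push Not at hσ
      obtain ⟨i₀, hi₀⟩ := hσ
      rw [hn n σ (fun h => hi₀ (h i₀))]
      simp only [hne _ n σ f i₀ hi₀, Complex.ofReal_zero]
      exact tendsto_const_nhds
  · -- non-triviality of the curvature field (S' = S on curvature strings)
    obtain ⟨F₁, G₁, H₁, hF₁, hG₁, hH₁, hne₁⟩ := hNT
    refine ⟨F₁, G₁, H₁, hF₁, hG₁, hH₁, ?_⟩
    dsimp only
    rw [hac, hac]
    exact hne₁
  · -- non-Gaussianity of the curvature field
    obtain ⟨f, g, h, A3, B1, B2, B3, C1, C2, C3, t1, t2, t3, t4, t5, t6, t7, t8, hne₃⟩ := hNG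
    refine ⟨f, g, h, A3, B1, B2, B3, C1, C2, C3, t1, t2, t3, t4, t5, t6, t7, t8, ?_⟩
    dsimp only
    rw [hac 3, hac 2, hac 1]
    exact hne₃
  · -- full-spectrum mass gap of S'
    intro n m k k' F G hF hG
    dsimp only
    by_cases hk : ∀ i, k i = r.curvature
    · by_cases hk' : ∀ j, k' j = r.curvature
      · obtain ⟨C, hC⟩ := hg1 n m (fun _ => r.curvature) (fun _ => r.curvature) F G hF hG
        refine ⟨C, fun t ht H hH => ?_⟩
        rw [ha _ _ ((happ _ _ _).2 ⟨(hrev _ _).2 hk, hk'⟩), ha _ _ ((hrev _ _).2 hk), ha _ _ hk']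
        have := hC t ht H hH
        rw [hcst] at this
        exact this
      · refine ⟨0, fun t ht H hH => ?_⟩
        rw [hn _ _ (fun h => hk' ((happ _ _ _).1 h).2), hn _ _ hk']
        simp
    · refine ⟨0, fun t ht H hH => ?_⟩
      rw [hn _ _ (fun h => hk ((hrev _ _).1 ((happ _ _ _).1 h).1)), hn _ _ (mt (hrev k _).1 hk)]
      simp

end Summit.QuantumFields.YangMills.Theorems.ContinuumFromLatticeGap

end
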